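import Summits.FinalStateConjecture.FinalStateConjecture.Theses.ZeroEnergyKerrOrBomb
import Summits.FinalStateConjecture.FinalStateConjecture.Theorems.ZeroEnergyRigidity.Negative.HorizonKillingScaling
import Literature.Geometry.Lorentzian.NonRotatingBlackHoleUniqueness
import Literature.Geometry.Lorentzian.StaticBlackHoleUniqueness
import Literature.Geometry.Lorentzian.StaticBlackHoleUniquenessProofs

/-!
# `ZeroEnergyRigidity`, line `global-horizon-killing-field` — stub `stub_nonRotatingUniqueness_of`

Crux `stmt-FinalStateConjecture-10690` (`Theses.ZeroEnergyKerrOrBomb.ZeroEnergyRigidity`), the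
NON-ROTATING endgame (S2) of the lead's skeleton, in its registered conditional form: the two
published theorems it rests on are the Literature named facts
`SudarskyWald1993_staticity` (Sudarsky–Wald 1993 Thms. 1–2 on the Chruściel–Wald maximal slice,
printed for `I⁺`-regular vacuum holes in Chruściel–Costa 2008 §7.2) and
`ChruscielGalloway2010_docStaticUniqueness` (Chruściel–Costa 2008 Thm. 1.4 as applied in §7.2,
analyticity removed by Chruściel–Galloway 2010), both in
`Literature/Geometry/Lorentzian/NonRotatingBlackHoleUniqueness.lean`; they enter as HYPOTHESES,
so the theorem below is unconditional and sorry-free.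

Statement proved (`stub_nonRotatingUniqueness_of`): the two facts imply the rigidity schema
`AlexakisIonescuKlainermanRigidity` (vacuum `I⁺`-regular presentation satisfying `C` ⇒ d.o.c.
isometric to a Kerr exterior) at the class
`C 𝓑 := 𝓑.IsIPlusRegularNonDegenerate ∧ (the h3-witness is c • T, c ≠ 0)` ("non-rotating,
non-degenerate, connected horizon").

Proof (Chruściel–Costa–Heusler 2012, §3.3.1 with Thm. 3.1): rescale the witness `c • T` to `T`
(`killing_witness_of_smul_witness`: surface gravity `c⁻¹κ ≠ 0`, Chruściel–Costa 2008 (2.8));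
Sudarsky–Wald gives hypersurface-orthogonality of `T` on `⟨⟨M_ext⟩⟩`; static uniqueness for a
static d.o.c. gives `IsIsometricToSchwarzschildExterior`, whose field `isIsometricToKerrExterior`
(Schwarzschild = Kerr with `a = 0`) is the conclusion of the schema.

References: D. Sudarsky, R. M. Wald, Phys. Rev. D 47 (1993) R5209; P. T. Chruściel, J. L. Costa,
arXiv:0806.0016, §7.2 and Thm. 1.4; P. T. Chruściel, G. J. Galloway, arXiv:1004.0513;
P. T. Chruściel, J. L. Costa, M. Heusler, Living Rev. Relativity 15 (2012) 7, §3.3.1, Thm. 3.1.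
-/

noncomputable section

-- summit = problem name (D-0017)
set_option linter.dupNamespace false

namespace Summit.FinalStateConjecture.FinalStateConjecture.Theorems.ZeroEnergyRigidity.GlobalHorizonKillingField.NonRotatingUniqueness

open Set Function Literature.Geometry.Lorentzian
open scoped Manifold ContDiff Topology

/-- **From a `c • T` witness to the `T` witness.**  If `c • T` (`c ≠ 0`, `T = 𝓑.killing`) is
nowhere zero on `𝓔⁺` and satisfies `∇_{cT}(cT) = κ (cT)` there, then `T` is nowhere zero on `𝓔⁺`
and `∇_T T = (c⁻¹κ) T` there (rescale the witness by `c⁻¹`,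
`Negative.isNonDegenerateHorizon_witness_smul`).  Chruściel–Costa 2008, §2.3 ((2.8): the surface
gravity scales with the normalisation of the Killing field). -/
theorem killing_witness_of_smul_witness (𝓑 : StationaryAFBlackHole.{0}) [𝓑.metric.HasLeviCivita]
    {c κ : ℝ} (hc : c ≠ 0) (hK : 𝓑.metric.IsKillingField (c • 𝓑.killing))
    (hne : ∀ p ∈ 𝓑.horizon, (c • 𝓑.killing) p ≠ 0)
    (htan : ∀ γ : ℝ → 𝓑.carrier, IsMIntegralCurve γ (c • 𝓑.killing) → γ 0 ∈ 𝓑.horizon →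
      ∀ t, γ t ∈ 𝓑.horizon)
    (hgeod : ∀ p ∈ 𝓑.horizon,
      𝓑.metric.leviCivita (c • 𝓑.killing) p ((c • 𝓑.killing) p) = κ • (c • 𝓑.killing) p) :
    (∀ p ∈ 𝓑.horizon, 𝓑.killing p ≠ 0) ∧
      ∀ p ∈ 𝓑.horizon,
        𝓑.metric.leviCivita 𝓑.killing p (𝓑.killing p) = (c⁻¹ * κ) • 𝓑.killing p := by
  obtain ⟨-, hne', -, hgeod'⟩ :=
    Negative.isNonDegenerateHorizon_witness_smul 𝓑 hK hne htan hgeod (inv_ne_zero hc)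
  have hT : c⁻¹ • (c • 𝓑.killing) = 𝓑.killing := by
    rw [smul_smul, inv_mul_cancel₀ hc, one_smul]
  rw [hT] at hne' hgeod'
  exact ⟨hne', hgeod'⟩

/-- **Registered stub `stub_nonRotatingUniqueness_of` (S2, conditional form).**  Sudarsky–Wald
staticity of the d.o.c. and static uniqueness for a static d.o.c. imply the rigidity schema at
"`I⁺`-regular, connected non-degenerate horizon, h3-witness a non-zero multiple of `T`"
(non-rotating).  Chruściel–Costa–Heusler 2012, §3.3.1 with Thm. 3.1. -/
theorem stub_nonRotatingUniqueness_of :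
    SudarskyWald1993_staticity → ChruscielGalloway2010_docStaticUniqueness →
    AlexakisIonescuKlainermanRigidity.{0} fun 𝓑 ↦ 𝓑.IsIPlusRegularNonDegenerate ∧
      ∀ [𝓑.metric.HasLeviCivita], ∃ c : ℝ, c ≠ 0 ∧ 𝓑.metric.IsKillingField (c • 𝓑.killing) ∧
        (∀ p ∈ 𝓑.horizon, (c • 𝓑.killing) p ≠ 0) ∧
        (∀ γ : ℝ → 𝓑.carrier, IsMIntegralCurve γ (c • 𝓑.killing) → γ 0 ∈ 𝓑.horizon →
          ∀ t, γ t ∈ 𝓑.horizon) ∧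
        ∃ κ : ℝ, κ ≠ 0 ∧ ∀ p ∈ 𝓑.horizon,
          𝓑.metric.leviCivita (c • 𝓑.killing) p ((c • 𝓑.killing) p) = κ • (c • 𝓑.killing) p := by
  intro h₁ h₂ 𝓑 _ _ hF hP hres hyp hvac
  obtain ⟨hreg, hrot⟩ := hyp
  obtain ⟨c, hc, hK, hne, htan, κ, hκ, hgeod⟩ := hrot
  obtain ⟨hne', hgeod'⟩ := killing_witness_of_smul_witness 𝓑 hc hK hne htan hgeod
  have hstat : 𝓑.metric.toPseudoRiemannianMetric.IsHypersurfaceOrthogonalOn 𝓑.killing 𝓑.doc :=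
    h₁ 𝓑 hreg.isIPlusRegular hvac hreg.horizon_nonempty hne'
      ⟨c⁻¹ * κ, mul_ne_zero (inv_ne_zero hc) hκ, hgeod'⟩
  exact (h₂ 𝓑 hF hP hres hreg.isIPlusRegular hstat hvac
    hreg.horizon_nonempty).isIsometricToKerrExterior

end Summit.FinalStateConjecture.FinalStateConjecture.Theorems.ZeroEnergyRigidity.GlobalHorizonKillingField.NonRotatingUniqueness

end
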